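import Summits.QuantumFields.BalabanUV.T4Continuum.Support.RegionGaugeCheckerboardNoGo
import Literature.MathematicalPhysics.QuantumFieldTheory.Balaban1983to89.B5G183RateUnitTower

/-!
# `BalabanUV.T4Continuum.Support.RegionGaugeCheckerboardTower` — NE2 (node U1a) formalisation swarm, SUPPLIER item «Δ1-COERC-ORTH-LINE» under the
# owner's sub-row `T4-U1a.S-NE2-D1-DIRICHLET°` (vector layer W1), FINDING F-ne2leaf09g9-1 file 4/4: THE TOWER SOCKET
# `hS : ∀ k, SliceCoercive (curlR (lev L k) M S) … (a·(lev L k)^d) c` OF THE STAR-BOND TOWER ENDs IS UNINHABITED ON THE COMPLEMENT OF A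
# DIAGONAL PAIR (unit b2b-balaban-t4-ne2-formalise-leaf-09, gen 9, v1)

HONEST FRAMING (T4-DAG p. 1).  [folklore] `U = 1`, the faithful single-scale star-bond region operator, ONE region `S✗ = T ∖ {w, w + e + e_ν}`
(`e ≠ ν`, `2 ≤ M e`, `2 ≤ M ν`), finite torus; a 20-line COROLLARY of `RegionGaugeCheckerboardNoGo.sliceCoercive_checker_le` (`c·H_n ≤ 6da`)
along the level sequence `n_k = lev L k = L^k` (`2 ≤ L`): the hypothesis `hS` of `DirichletStarVectorTower.towerLimitRate_star_of(_linear)`,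
`DirichletStarClassPoincare.towerLimitRate_star_renorm_of_interior`, `RegionInteriorW2.towerLimitRate_star_renorm_box_of_slice` (all displayed
with ONE constant `c` for ALL levels) is FALSE for `S = S✗` and every `c > 0`.  Owner R31 (b) (journal l.20053): booked as a LOCATED no-go;
repair = a level-dependent class `c_k` (owner's conjecture `c_k ≥ c₀/(k+1)`; this file is the matching upper bound `c_k·H_{L^k} ≤ 6da`).
Nothing printed is a hypothesis; NE2 (U1a) NOT proved; spine PROVED 0/9 unchanged; NOT [B9] (3.23)–(3.27) as printed (nothing about the
printed regions with their collars (3.16)); NOT infinite volume, NOT the mass gap, NOT Clay.  HONEST DEPENDENCY (verbatim): «continuum YM on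
T⁴ ⇐ BetaPertH ∧ nine spine estimates (0/9 proved); BetaPertH ⇐ (D1) ∧ (D4) ∧ CAP+tail; G-an2-4 gates asym, D1 and NE2/3/4.»

ABSOLUTE RULE (cell, verbatim): «No internally-minted statement may enter as a cited fact. Every hypothesis is either kernel-proved in
this package or a verbatim quotation of a PUBLISHED theorem with page reference. The manuscript(s) under audit are NOT citable for
their own disputed steps — they are the thing under adjudication; programme-internal (2001/route/tribunal) claims are never citable.»
[folklore] throughout; no def, no `def … : Prop`.  NOT CLAIMED: anything about other regions; the lower bound `c_k ≳ 1/k`; NE2; NE3.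
-/

noncomputable section

open scoped BigOperators ComplexConjugate Matrix
open Finset

namespace Summit.QuantumFields.BalabanUV.T4Continuum.RegionGaugeCheckerboardTower

open Literature.MathematicalPhysics.QuantumFieldTheory.Balaban1983to89.B5Prop11Plancherel (Tor fine unitVec)
open Literature.MathematicalPhysics.QuantumFieldTheory.Balaban1983to89.B5G183RateUnitTower (lev)
open Summit.QuantumFields.BalabanUV.T4Continuum
open Summit.QuantumFields.BalabanUV.T4Continuum.RegionScalarCompression (QOm GOm)
open Summit.QuantumFields.BalabanUV.T4Continuum.RegionGaugeFixedVector (curlR gradR avgR)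
open Summit.QuantumFields.BalabanUV.T4Continuum.RegionGaugeSlice (SliceCoercive)
open Summit.QuantumFields.BalabanUV.T4Continuum.RegionGaugeCheckerboardField (checker)
open Summit.QuantumFields.BalabanUV.T4Continuum.RegionGaugeCheckerboardNoGo (harm harm_unbounded sliceCoercive_checker_le)

variable {d : ℕ} (L : ℕ) [NeZero L] (M : Fin d → ℕ) [hM : ∀ μ, NeZero (M μ)] (a a' : ℝ) (w : Tor M) (e ν : Fin d)

omit [NeZero L] in
/-- `k + 1 ≤ n_k = L^k` for `2 ≤ L`. [folklore] -/
theorem succ_le_lev (hL : 2 ≤ L) (k : ℕ) : k + 1 ≤ lev L k := by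
  induction k with
  | zero => exact le_of_eq (show 1 = lev L 0 from rfl).symm.symm
  | succ k ih =>
    show k + 1 + 1 ≤ L * lev L k
    calc k + 1 + 1 ≤ 2 * (k + 1) := by omega
      _ ≤ L * lev L k := Nat.mul_le_mul hL ih

/-- the harmonic numbers are monotone. [folklore] -/
theorem harm_mono {m n : ℕ} (h : m ≤ n) : harm m ≤ harm n :=
  sum_le_sum_of_subset_of_nonneg (range_mono h) fun t _ _ => by positivity

/-- **THE TOWER SOCKET IS UNINHABITED ON THE COMPLEMENT OF A DIAGONAL PAIR**: for `2 ≤ L`, `0 ≤ a`, `0 < a′` and every `c > 0`, the displayed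
W1 binder of the star-bond tower ENDs — `∀ k, SliceCoercive (curlR (lev L k) M S✗) (gradR …) (GOm … a′ …) (QOm …) (avgR …) (a·(lev L k)^d) c` —
is FALSE on `S✗ = T ∖ {w, w + e + e_ν}` (`e ≠ ν`, `2 ≤ M e`, `2 ≤ M ν`): level `k` forces `c·H_{L^k} ≤ 6da` and `H_{L^k} ≥ H_{k+1} → ∞`. [folklore] -/
theorem not_sliceCoercive_tower_checker (hL : 2 ≤ L) (hMe : 2 ≤ M e) (hMν : 2 ≤ M ν) (hne : e ≠ ν) (ha : 0 ≤ a) (ha' : 0 < a')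
    {c : ℝ} (hc : 0 < c) :
    ¬ ∀ k : ℕ, SliceCoercive (curlR (lev L k) M (checker M w e ν)) (gradR (lev L k) M (checker M w e ν))
      (GOm (lev L k) M a' (checker M w e ν)) (QOm (lev L k) M (checker M w e ν)) (avgR (lev L k) M (checker M w e ν))
      (a * ((lev L k : ℕ) : ℝ) ^ d) c := by
  intro hS
  obtain ⟨m, hm⟩ := harm_unbounded (6 * d * a / c)
  have h := sliceCoercive_checker_le (lev L m) M w e ν a a' hMe hMν hne ha ha' hc.le (hS m)
  have hmono : c * harm (m + 1) ≤ c * harm (lev L m) := mul_le_mul_of_nonneg_left (harm_mono (succ_le_lev L hL m)) hc.le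
  rw [div_lt_iff₀ hc] at hm
  linarith

/-- the same per level, quantitatively: **`c_k · H_{k+1} ≤ 6·d·a`** for any slice constant `c_k ≥ 0` at level `n_k = L^k` (`2 ≤ L`) — the
matching UPPER bound to the owner's R31 (b)(iii) repair conjecture `c_k ≥ c₀/(k+1)`. [folklore] -/
theorem sliceCoercive_lev_checker_le (hL : 2 ≤ L) (hMe : 2 ≤ M e) (hMν : 2 ≤ M ν) (hne : e ≠ ν) (ha : 0 ≤ a) (ha' : 0 < a') (k : ℕ)
    {c : ℝ} (hc : 0 ≤ c)
    (hS : SliceCoercive (curlR (lev L k) M (checker M w e ν)) (gradR (lev L k) M (checker M w e ν))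
      (GOm (lev L k) M a' (checker M w e ν)) (QOm (lev L k) M (checker M w e ν)) (avgR (lev L k) M (checker M w e ν))
      (a * ((lev L k : ℕ) : ℝ) ^ d) c) :
    c * harm (k + 1) ≤ 6 * d * a :=
  (mul_le_mul_of_nonneg_left (harm_mono (succ_le_lev L hL k)) hc).trans
    (sliceCoercive_checker_le (lev L k) M w e ν a a' hMe hMν hne ha ha' hc hS)

end Summit.QuantumFields.BalabanUV.T4Continuum.RegionGaugeCheckerboardTower

end
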